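import Summits.ABC.IUTFork.LanaGMData
import HarnessLib

/-!
# L-LANA objects IV: the Θ-link as a full poly-isomorphism of BPSs; Step 1 and (Ind1), (Ind2) (LANA §3.5, §6, §7.1)

Record-only file (D-0012) of the abc-iut cell (seat abc-iut-c312-4, L-LANA level, plan/LLANA-SPEC N16 (the
link itself), N14 Step 1, and the hazards N17); TAKES NO SIDE on [IUTchIII] Cor. 3.12. Over the printed
objects of `LanaGMData.lean` (étale-unit BPS = `F^{⊢×μ}`-prime-strip, `LanaBPS` = Def. 4.1.6) it types,
from Project LANA's interim report (bib `LANA2026Report`, read on the page):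

* §3.5 p. 19: "a certain (usually nonempty) set of isomorphisms from `A` to `B` is called a
  poly-isomorphism, and the set of all isomorphisms from `A` to `B` is called the full poly-isomorphism …
  in order to identify the local Galois groups `†G_v` and `‡G_v` across our link, this identification should
  be the full poly-isomorphism." — `fullPolyIso`, `EtaleBPS.coricIdentification`.
* §7.1 (b) p. 38: "a `Θ^{×μ}`-link is the full poly-isomorphism (gluing) from `†B_Θ` to `‡B_q`, and it gives
  the following situation: (a) (compatibility with étale-like coric data) this gluing is compatible with
  the étale-like mono-analytic portions, that is, with the coric identifications of the `D^⊢`-prime-strips;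
  (b) (correspondence between the Θ-pilot value-group BPS and the `q`-pilot value-group BPS) it gives the
  isomorphism between the Θ-pilot value-group BPS on the domain Hodge theater `†HT` and the `q`-pilot
  value-group BPS on the codomain Hodge theater `‡HT`; (c) (mutual alienness of the AHSs) the holomorphic
  structures on the two sides, that is, the ring/scheme structures, are not identified." — `ThetaLink`
  (the two BPSs with equal product formula), `ThetaLink.gluing` (= all isomorphisms), (a) `etalePart`,
  (b) `valueIso`/`valueIso_unique`, (c) recorded: a BPS carries no ring structure, so nothing in the typed
  link CAN identify one (`gluingEquivUnit`: the gluing is exactly the set of étale-unit isomorphisms).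
* §6 p. 31: "(Ind1) … we need to write `G_v` as a quotient of "`Π_v` equipped with an interpretation as a
  fundamental group." To do this, one must fix an isomorphism between `Π_v/Δ_v` and `G_v`. Because of this
  choice, one must accept the indeterminacy arising from `Aut(G_v)`. (Ind2) Next, one needs to write
  `O^{×μ}_v` in the input BPS, as a monoid with `G_v`-action, as a quotient of `O^×_v` (compatibly with the
  compact structure). For this reason, an indeterminacy arises from the automorphism group of `O^×_v` as a
  monoid with `G_v`-action."; §6.2 (b) p. 33 / §9.1 (a) p. 44 Step 1: "Choose an isomorphism between the
  given BPS and the Θ-pilot BPS associated to a Hodge theater … Since this choice is not canonical, Ind1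
  and Ind2 arise" — `Realisation` (a Step-1 choice = an isomorphism of the étale-unit portion with the
  REFERENCE étale-unit BPS of the Hodge theater), `realisation_nonempty` (Step 1 is executable),
  `Realisation.discrepancy`/`eq_trans_discrepancy`/`discrepancy_unique` (two choices differ by a UNIQUE
  automorphism of the reference: its `G_v`-components = (Ind1), its unit components = (Ind2), the latter
  equivariant along the former and preserving `{I^κ_H}` — `ind2_equivariant`, `ind2_compact`).
* Rem. 8.2.1 p. 42 (typing hazard, LLANA-SPEC N17): "the assertion that two BPSs are "linked," in the
  sense that there exists an isomorphism between them, is a vacuous assertion since the category of BPSs is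
  a connected groupoid. Therefore, the concept of a "link" needs a more precise definition that can be
  formalized in Lean." — `ThetaLink.gluing_nonempty`. (IPL)/(SHE)/(APT) (§8.2 pp. 41–42, quoting [IUTchIII]
  Rem. 3.11.1 (iii), (iv)) are NOT typable as printed (LLANA-SPEC N17: "exactly the contested content") and
  are recorded in the docstring of `ThetaLink` only.

Modelling notes. (i) Rem. 7.1.1 p. 38: "In the original papers, there are multiple variants of Θ-links,
such as Θ-, `Θ^{×μ}`-, `Θ^{×μ}_{gau}`-, `Θ^{×μ}_{LGP}`-, and `Θ^{×μ}_{lgp}`-links … What is needed in the present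
paper is the `Θ^{×μ}_{LGP}`-link" — this file types LANA's simplified `Θ^{×μ}`-link between BPSs; the
value-group portions `†B_Θ^{val}`, `‡B_q^{val}` are ANY two with equal product formula here (for the printed
Θ-pilot and `q`-pilot BPSs of §7.1 (a)/§4.2 (c) that equality is `LocalDegrees.thetaBPS_PF` of `ForkHexagon.lean`,
XIV). (ii) (Ind3) (p. 31: "instead of just `VC(O)`, we must take into account all such subsets") concerns
volume containers (LLANA-SPEC N11) and is not in this file. NOT here: Hodge theaters, log-links, the
`η`-algorithm beyond Step 1 (sibling `LanaEtaRss.lean`), any judgement.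
-/

noncomputable section

namespace Summit.ABC
namespace IUTFork

/-! ## 1. Poly-isomorphisms (§3.5) -/

/-- **§3.5 p. 19**: "the set of all isomorphisms from `A` to `B` is called the full poly-isomorphism" —
for any TYPE of isomorphisms (LANA's group-level BPS/strip isomorphisms are not hom-sets of a declared
category), the whole of it; a poly-isomorphism is any (usually nonempty) subset. For objects of a category
the corpus notion is L5-t1's `Literature.IUT.HodgeTheaters.PolyIso`/`IsPolyIso` ([IUTchI] §0), which this
does not duplicate. [cite: LANA2026Report, §3.5 p. 19] -/
def fullPolyIso (I : Type) : Set I := Set.univ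

/-- **§3.5 p. 19, coricity of `G_v`**: "in order to identify the local Galois groups `†G_v` and `‡G_v` across
our link, this identification should be the full poly-isomorphism" — for `D^⊢`-prime-strips (étale BPSs)
the coric identification is the set of ALL isomorphisms. [cite: LANA2026Report, §3.5 p. 19] -/
def EtaleBPS.coricIdentification {V : Type} {ref : V → GMDataK} (D D' : EtaleBPS ref) : Set (D.Iso D') :=
  fullPolyIso (D.Iso D')

/-- The coric identification is nonempty ("(usually nonempty)"; here: always, both being copies of
`{G_v}`). [cite: LANA2026Report, §3.5 p. 19] -/
theorem EtaleBPS.coricIdentification_nonempty {V : Type} {ref : V → GMDataK} (D D' : EtaleBPS ref) :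
    (D.coricIdentification D').Nonempty :=
  (D.iso_nonempty D').elim fun Φ => ⟨Φ, trivial⟩

/-! ## 2. The Θ-link (§7.1 (b)) -/

/-- **LANA §7.1 (b) (the `Θ^{×μ}`-link), data**: "In `‡HT`, consider the `q`-pilot BPS `‡B_q`, and in `†HT`,
consider the Θ-pilot BPS `†B_Θ`. Then, roughly speaking, a `Θ^{×μ}`-link is the full poly-isomorphism
(gluing) from `†B_Θ` to `‡B_q`". Typed: the two BPSs (over the same coric reference `{G_v ↷ O^{×μ}_v, I^κ}`,
§3.6: `O^{×μ}_v` "is chosen … as an object to be shared") whose value-group portions have the same product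
formula (Lemma 4.1.7: exactly the condition for the gluing to be nonempty; modelling note (i)); the gluing
itself is `ThetaLink.gluing`. NOT TYPABLE AS PRINTED and recorded here only (LLANA-SPEC N17), from §8.2
pp. 41–42 quoting [IUTchIII] Rem. 3.11.1: (IPL) "[the] output data is constructed in such a way that it is
linked/related, via full poly-isomorphisms of `F^{⊩▶×μ}`-prime-strips induced by operations in the
algorithm, to the input data prime-strip"; (SHE) "[the] construction of this output data, as well as the
output data itself, is expressed in terms that are simultaneously valid/executable/well-defined relative to
both the arithmetic holomorphic structure that gives rise to the Θ-pilot object in the domain of the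
Θ-link … and the arithmetic holomorphic structure that gives rise to the input data prime-strip … in the
codomain of the Θ-link"; (APT) "[the] parallel transport mechanism does not consist of a simple instance
of transport of some set-theoretic region … Rather, it consists of a construction algorithm that is
simultaneously valid/executable/well-defined with respect to the arithmetic holomorphic structures in the
domain and codomain of the Θ-link". [cite: LANA2026Report, §7.1 (b) p. 38] -/
structure ThetaLink {V : Type} (ref : V → GMDataK) [Fintype V] (bad : Finset V) : Type 1 where
  /-- `†B_Θ`, the Θ-pilot BPS in the domain Hodge theater `†HT` -/
  thetaSide : LanaBPS ref bad
  /-- `‡B_q`, the `q`-pilot BPS in the codomain Hodge theater `‡HT` -/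
  qSide : LanaBPS ref bad
  /-- equal product formulas (Lemma 4.1.7; for the printed pilots: XIV `thetaBPS_PF`) -/
  PF_eq : thetaSide.val.PF = qSide.val.PF

namespace ThetaLink

variable {V : Type} {ref : V → GMDataK} [Fintype V] {bad : Finset V} (L : ThetaLink ref bad)

/-- "the full poly-isomorphism (gluing) from `†B_Θ` to `‡B_q`": ALL isomorphisms of BPSs (Def. 4.1.6 (2)).
[cite: LANA2026Report, §7.1 (b) p. 38] -/
def gluing : Set (L.thetaSide.Iso L.qSide) := fullPolyIso _

/-- Every isomorphism of BPSs belongs to the gluing. [cite: LANA2026Report, §7.1 (b) p. 38] -/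
theorem mem_gluing (Φ : L.thetaSide.Iso L.qSide) : Φ ∈ L.gluing := trivial

/-- **Rem. 8.2.1 for the Θ-link**: the gluing is nonempty — "the assertion that two BPSs are "linked," in
the sense that there exists an isomorphism between them, is a vacuous assertion".
[cite: LANA2026Report, Rem. 8.2.1 p. 42] -/
theorem gluing_nonempty : L.gluing.Nonempty :=
  ⟨L.thetaSide.isoOfPFEq L.qSide L.PF_eq, trivial⟩

/-- **(a) compatibility with étale-like coric data**: each member of the gluing induces an isomorphism of
the `D^⊢`-prime-strips (étale portions `{†G_v} ⥲ {‡G_v}`), which lies in their coric identification (the full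
poly-isomorphism, §3.5). [cite: LANA2026Report, §7.1 (b) (a) p. 38] -/
def etalePart (Φ : L.thetaSide.Iso L.qSide) : L.thetaSide.unit.etale.Iso L.qSide.unit.etale := Φ.1.etale

/-- (a), membership form. [cite: LANA2026Report, §7.1 (b) (a) p. 38] -/
theorem etalePart_mem (Φ : L.thetaSide.Iso L.qSide) :
    L.etalePart Φ ∈ L.thetaSide.unit.etale.coricIdentification L.qSide.unit.etale := trivial

/-- **(b) THE isomorphism of value-group BPSs** "between the Θ-pilot value-group BPS on the domain Hodge
theater `†HT` and the `q`-pilot value-group BPS on the codomain Hodge theater `‡HT`" (Lemma 4.1.7).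
[cite: LANA2026Report, §7.1 (b) (b) p. 38] -/
def valueIso : ValueGroupBPS.Iso L.thetaSide.val L.qSide.val := ValueGroupBPS.isoOfPFEq L.PF_eq

/-- (b) is canonical: every member of the gluing has THIS value-group component (XIII
`ValueGroupBPS.iso_subsingleton`). [cite: LANA2026Report, §7.1 (b) (b) p. 38] -/
theorem valueIso_unique (Φ : L.thetaSide.Iso L.qSide) : Φ.2 = L.valueIso :=
  (ValueGroupBPS.iso_subsingleton _ _).elim _ _

/-- **(c), what the types can say**: the gluing is in bijection with the isomorphisms of the ÉTALE-UNIT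
portions alone (XIII/`LanaGMData` `isoEquivUnit`): a member of the link is a family of equivariant pairs
`(†G_v ⥲ ‡G_v, †M_v ⥲ ‡M_v)` respecting compact structures and nothing else — no ring/scheme structure is, or
can be, identified by it ("mutual alienness of the AHSs"). [cite: LANA2026Report, §7.1 (b) (c) p. 38] -/
def gluingEquivUnit : L.gluing ≃ L.thetaSide.unit.Iso L.qSide.unit :=
  (Equiv.Set.univ _).trans (L.thetaSide.isoEquivUnit L.qSide L.PF_eq)

end ThetaLink

/-! ## 3. Step 1 and the indeterminacies (Ind1), (Ind2) (§6 p. 31, §6.2 (b), §9.1 (a)) -/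

section StepOne

variable {V : Type} {ref : V → GMDataK}

/-- Two isomorphisms of GM-data with compact structure agree if their group and monoid components do.
[folklore] -/
theorem GMDataK.Iso.ext' {X Y : GMDataK} {φ ψ : GMDataK.Iso X Y} (hG : φ.eG = ψ.eG) (hM : φ.eM = ψ.eM) :
    φ = ψ := by
  obtain ⟨⟨eG, eM, h1⟩, h2⟩ := φ
  obtain ⟨⟨eG', eM', h1'⟩, h2'⟩ := ψ
  cases hG; cases hM; rfl

/-- **Step 1 (§6.2 (b) p. 33; §9.1 (a) p. 44)**: "one first regards the étale-unit portion of this input BPS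
as being isomorphic to the étale-unit BPS of the form `Π_v/Δ_v ↷ O^×_v/O^μ_v` inside a Hodge theater" /
"Choose an isomorphism between the given BPS and the Θ-pilot BPS associated to a Hodge theater". A
REALISATION of an étale-unit BPS `B` = an isomorphism to the reference étale-unit BPS (`EtaleUnitBPS.std`:
the one the Hodge theater supplies, §4.2 (c)). [cite: LANA2026Report, §6.2 (b) p. 33] -/
def Realisation (B : EtaleUnitBPS ref) : Type := B.Iso (EtaleUnitBPS.std ref)

/-- Step 1 is executable: a realisation exists (Def. 4.1.2: `B` is "abstractly isomorphic to" the
reference). [cite: LANA2026Report, §6.2 (b) p. 33] -/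
theorem realisation_nonempty (B : EtaleUnitBPS ref) : Nonempty (Realisation B) :=
  B.iso_nonempty (EtaleUnitBPS.std ref)

/-- The automorphisms of the reference étale-unit BPS `{(G_v ↷ O^{×μ}_v, {I^κ_H}_H)}_v`: families of pairs
`(α_{G,v}, α_{M,v})` — the group in which the indeterminacies (Ind1), (Ind2) of Step 1 live.
[cite: LANA2026Report, §6 p. 31] -/
abbrev RefAut (ref : V → GMDataK) : Type := (EtaleUnitBPS.std ref).Iso (EtaleUnitBPS.std ref)

namespace Realisation

variable {B : EtaleUnitBPS ref} (c c' : Realisation B)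

/-- "Since this choice is not canonical, Ind1 and Ind2 arise": the DISCREPANCY of two Step-1 choices, an
automorphism of the reference. [cite: LANA2026Report, §6.2 (b) p. 33] -/
def discrepancy : RefAut ref := EtaleUnitBPS.Iso.trans (EtaleUnitBPS.Iso.symm c) c'

/-- Any two realisations differ by their discrepancy: `c′ = c ∘ (c⁻¹ ∘ c′)`. [cite: LANA2026Report, §6.2 (b) p. 33] -/
theorem eq_trans_discrepancy : c' = EtaleUnitBPS.Iso.trans c (c.discrepancy c') := by
  funext v
  refine GMDataK.Iso.ext' (ContinuousMulEquiv.ext fun x => ?_) (ContinuousMulEquiv.ext fun x => ?_)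
  · change (c' v).eG x = (c' v).eG ((c v).eG.symm ((c v).eG x))
    rw [ContinuousMulEquiv.symm_apply_apply]
  · change (c' v).eM x = (c' v).eM ((c v).eM.symm ((c v).eM x))
    rw [ContinuousMulEquiv.symm_apply_apply]

/-- … and by nothing else: the discrepancy is the unique automorphism `α` of the reference with
`c′ = c ∘ α` — the Step-1 choices form a TORSOR under `RefAut` (this is the precise content of "the
indeterminacy arising from" the automorphism groups). [cite: LANA2026Report, §6 p. 31] -/
theorem discrepancy_unique (α : RefAut ref) (h : c' = EtaleUnitBPS.Iso.trans c α) :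
    α = c.discrepancy c' := by
  subst h
  funext v
  refine GMDataK.Iso.ext' (ContinuousMulEquiv.ext fun x => ?_) (ContinuousMulEquiv.ext fun x => ?_)
  · change (α v).eG x = (α v).eG ((c v).eG ((c v).eG.symm x))
    rw [ContinuousMulEquiv.apply_symm_apply]
  · change (α v).eM x = (α v).eM ((c v).eM ((c v).eM.symm x))
    rw [ContinuousMulEquiv.apply_symm_apply]

end Realisation

namespace RefAut

variable (α : RefAut ref) (v : V)

/-- **(Ind1)**: "one must accept the indeterminacy arising from `Aut(G_v)`" — the `G_v`-component of an
automorphism of the reference, a bi-continuous automorphism of `G_v`. [cite: LANA2026Report, §6 (Ind1) p. 31] -/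
def ind1 : (ref v).G ≃ₜ* (ref v).G := (α v).eG

/-- **(Ind2)**: "an indeterminacy arises from the automorphism group of `O^×_v` as a monoid with
`G_v`-action" "(compatibly with the compact structure)" — the unit component, an automorphism of the monoid
`M_v = O^{×μ}_v`. [cite: LANA2026Report, §6 (Ind2) p. 31] -/
def ind2 : (ref v).M ≃ₜ* (ref v).M := (α v).eM

/-- The (Ind2)-component is equivariant ALONG the (Ind1)-component: `α_M(g·m) = α_G(g)·α_M(m)` ("as a
monoid with `G_v`-action"). [cite: LANA2026Report, §6 (Ind2) p. 31] -/
theorem ind2_equivariant (g : (ref v).G) (m : (ref v).M) : α.ind2 v (g • m) = α.ind1 v g • α.ind2 v m :=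
  (α v).map_smul g m

/-- The (Ind2)-component respects the compact structure: `α_M(I^κ_H) = I^κ_{α_G(H)}` ("compatibly with the
compact structure"). [cite: LANA2026Report, §6 (Ind2) p. 31] -/
theorem ind2_compact (H : OpenSubgroup (ref v).G) :
    (α.ind2 v : (ref v).M → (ref v).M) '' ((ref v).N H) = (ref v).N (imageOpenSubgroup (α.ind1 v) H) :=
  (α v).map_N H

/-- When the (Ind1)-component is trivial, the (Ind2)-component is a `G_v`-EQUIVARIANT automorphism of
`O^{×μ}_v` preserving every `I^κ_H` — LANA's "automorphism … of `O^×_v` as a monoid with `G_v`-action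
(compatibly with the compact structure)" read on `O^{×μ}_v`. [cite: LANA2026Report, §6 (Ind2) p. 31] -/
theorem ind2_of_ind1_trivial (h : α.ind1 v = ContinuousMulEquiv.refl _) (g : (ref v).G) (m : (ref v).M)
    (H : OpenSubgroup (ref v).G) :
    α.ind2 v (g • m) = g • α.ind2 v m ∧
      (α.ind2 v : (ref v).M → (ref v).M) '' ((ref v).N H) = (ref v).N H := by
  refine ⟨?_, ?_⟩
  · rw [ind2_equivariant, h]; rfl
  · rw [ind2_compact, h, imageOpenSubgroup_refl]

end RefAut

/-- **What a member of the Θ-link's gluing determines, given Step-1 realisations on both sides**: an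
automorphism of the reference (realise `‡B_q`, go back through the gluing member, un-realise `†B_Θ`) — the
(Ind1)/(Ind2) "coordinates" of that member. Every automorphism of the reference so arises (the gluing is
FULL), which is the typed form of "we have no choice but to adopt the standpoint of constructing a theory
in which no problem arises no matter which identification `†G_v ⥲ ‡G_v` is adopted" (§3.5 p. 19).
[cite: LANA2026Report, §3.5 p. 19, §7.1 (b) p. 38] -/
def ThetaLink.coordinates [Fintype V] {bad : Finset V} (L : ThetaLink ref bad)
    (cΘ : Realisation L.thetaSide.unit) (cq : Realisation L.qSide.unit) :
    L.gluing ≃ RefAut ref :=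
  L.gluingEquivUnit.trans
    { toFun := fun Φ => EtaleUnitBPS.Iso.trans (EtaleUnitBPS.Iso.symm cΘ) (EtaleUnitBPS.Iso.trans Φ cq)
      invFun := fun α => EtaleUnitBPS.Iso.trans cΘ (EtaleUnitBPS.Iso.trans α (EtaleUnitBPS.Iso.symm cq))
      left_inv := fun Φ => by
        funext v
        refine GMDataK.Iso.ext' (ContinuousMulEquiv.ext fun x => ?_) (ContinuousMulEquiv.ext fun x => ?_)
        · change (cq v).eG.symm ((cq v).eG ((Φ v).eG ((cΘ v).eG.symm ((cΘ v).eG x)))) = (Φ v).eG x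
          rw [ContinuousMulEquiv.symm_apply_apply, ContinuousMulEquiv.symm_apply_apply]
        · change (cq v).eM.symm ((cq v).eM ((Φ v).eM ((cΘ v).eM.symm ((cΘ v).eM x)))) = (Φ v).eM x
          rw [ContinuousMulEquiv.symm_apply_apply, ContinuousMulEquiv.symm_apply_apply]
      right_inv := fun α => by
        funext v
        refine GMDataK.Iso.ext' (ContinuousMulEquiv.ext fun x => ?_) (ContinuousMulEquiv.ext fun x => ?_)
        · change (cq v).eG ((cq v).eG.symm ((α v).eG ((cΘ v).eG ((cΘ v).eG.symm x)))) = (α v).eG x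
          rw [ContinuousMulEquiv.apply_symm_apply, ContinuousMulEquiv.apply_symm_apply]
        · change (cq v).eM ((cq v).eM.symm ((α v).eM ((cΘ v).eM ((cΘ v).eM.symm x)))) = (α v).eM x
          rw [ContinuousMulEquiv.apply_symm_apply, ContinuousMulEquiv.apply_symm_apply] }

end StepOne

end IUTFork

end Summit.ABC

end
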